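import Summits.Ventures.HodgeRepro2.T5IwasawaSplit

/-!
# T5DoublingTransport — why `formHJ J`, `k kᴴ = 1` and `doubling g` are the doubled objects
# (blind cell pub-hodge-repro2; support for route/T5-N4-p5.md, N4.3 = (R3), step (P1))

The doubled space `W ⊕ W⁻` carries the form `fromBlocks J 0 0 (−J)` in the coordinates `(a, b)`
(`a ∈ W`, `b ∈ W⁻`), the embedded `i(g, 1)` is `fromBlocks g 0 0 1`, and — for `J` a hermitian
involution, so that the majorant of `J` on `W` is the standard form — the majorant is the
standard form `|a|² + |b|²`.  The coordinates `(y, y′)` of `Y_n ⊕ Y_n^∇` (`Y_n = {(w, w)}`,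
`Y_n^∇ = {(w, −w)}`) are `(a, b) = P (y, y′)` with `P = fromBlocks 1 1 1 (−1)`
(`a = y + y′`, `b = y − y′`).  This file transports the three objects through `P`:

* `transport_form`: `Pᴴ · fromBlocks J 0 0 (−J) · P = 2 • formHJ J` — the doubled form in the
  `(y, y′)` coordinates is (twice) `formHJ J = fromBlocks 0 J J 0`, NOT `fromBlocks 0 1 1 0`
  unless `J = 1`;
* `transport_majorant`: `Pᴴ · P = 2 • 1` — the majorant in the `(y, y′)` coordinates is (twice)
  the standard form, so the maximal compact is `{k : k kᴴ = 1} ∩ U(formHJ J)` in those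
  coordinates (`T5ParabolicBlocks.basisChange_mul_self`);
* `transport_embedding`: `P⁻¹ · fromBlocks g 0 0 1 · P = T5ParabolicBlocks.doubling g`
  (`T5ParabolicBlocks.doubling_eq_conj`, restated with the inverse `P⁻¹ = ½ P`);
* `transport_preserves`: `x` preserves `fromBlocks J 0 0 (−J)` iff `P⁻¹ x P` preserves `formHJ J`
  — so `U(W ⊕ W⁻)` in the `(a, b)` coordinates IS `U(formHJ J)` in the `(y, y′)` coordinates;
  in particular `fromBlocks g 0 0 1 ∈ U(W ⊕ W⁻)` iff `g ∈ U(J)` (`diag_preserves_iff`).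

Together with `T5IwasawaSplit.exists_factorisation` and `T5IwasawaClaim.normSq_det_levi_exists`
this identifies the kernel objects with the doubling-method objects of N4.3 (P1) up to the
printed choice of `Y_n`, `Y_n^∇` ([PS-R87] / Liu, cited in the prose).  Mathlib + own prefix;
no sorry; axioms ⊆ {propext, Classical.choice, Quot.sound}.
-/

namespace Summit.Ventures.HodgeRepro2.T5DoublingTransport

open Matrix
open T5IwasawaSplit

variable {n : Type*} [Fintype n] [DecidableEq n]

omit [Fintype n] in
/-- The basis change `P = fromBlocks 1 1 1 (−1)` is hermitian. -/
theorem basisChange_conjTranspose :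
    (fromBlocks 1 1 1 (-1) : Matrix (n ⊕ n) (n ⊕ n) ℂ)ᴴ =
      (fromBlocks 1 1 1 (-1) : Matrix (n ⊕ n) (n ⊕ n) ℂ) := by
  simp [fromBlocks_conjTranspose]

/-- `Pᴴ P = 2 • 1`: the standard majorant of the `(a, b)` coordinates is twice the standard form
of the `(y, y′)` coordinates. -/
theorem transport_majorant :
    (fromBlocks 1 1 1 (-1) : Matrix (n ⊕ n) (n ⊕ n) ℂ)ᴴ *
        (fromBlocks 1 1 1 (-1) : Matrix (n ⊕ n) (n ⊕ n) ℂ) =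
      (2 : ℂ) • (1 : Matrix (n ⊕ n) (n ⊕ n) ℂ) := by
  rw [basisChange_conjTranspose, T5ParabolicBlocks.basisChange_mul_self]

/-- `Pᴴ · fromBlocks J 0 0 (−J) · P = 2 • formHJ J`: the doubled form in the `(y, y′)`
coordinates. -/
theorem transport_form (J : Matrix n n ℂ) :
    (fromBlocks 1 1 1 (-1) : Matrix (n ⊕ n) (n ⊕ n) ℂ)ᴴ * fromBlocks J 0 0 (-J) *
        (fromBlocks 1 1 1 (-1) : Matrix (n ⊕ n) (n ⊕ n) ℂ) = (2 : ℂ) • formHJ J := by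
  rw [basisChange_conjTranspose, formHJ, fromBlocks_smul]
  simp only [fromBlocks_multiply, Matrix.one_mul, Matrix.mul_one, Matrix.mul_zero,
    Matrix.mul_neg, Matrix.neg_mul, neg_neg, add_zero, zero_add, smul_zero, two_smul]
  rw [fromBlocks_inj]
  refine ⟨?_, ?_, ?_, ?_⟩ <;> abel

/-- `½ P` is the inverse of `P`. -/
theorem basisChange_inv :
    (fromBlocks 1 1 1 (-1) : Matrix (n ⊕ n) (n ⊕ n) ℂ) *
        ((1 / 2 : ℂ) • (fromBlocks 1 1 1 (-1) : Matrix (n ⊕ n) (n ⊕ n) ℂ)) = 1 := by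
  rw [Matrix.mul_smul, T5ParabolicBlocks.basisChange_mul_self]
  ext i j
  by_cases h : i = j <;> simp [h, Matrix.one_apply]

/-- `P⁻¹ · fromBlocks g 0 0 1 · P = doubling g`: the embedded `i(g, 1)` in the `(y, y′)`
coordinates (restatement of `T5ParabolicBlocks.doubling_eq_conj`). -/
theorem transport_embedding (g : Matrix n n ℂ) :
    ((1 / 2 : ℂ) • (fromBlocks 1 1 1 (-1) : Matrix (n ⊕ n) (n ⊕ n) ℂ)) * fromBlocks g 0 0 1 *
        (fromBlocks 1 1 1 (-1) : Matrix (n ⊕ n) (n ⊕ n) ℂ) = T5ParabolicBlocks.doubling g := by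
  rw [← T5ParabolicBlocks.doubling_eq_conj, Matrix.smul_mul, Matrix.smul_mul]

/-- `x` preserves `F` iff `Q x P` preserves `Pᴴ F P` (`P Q = 1`, any `F`). -/
theorem preserves_conj (F P Q x : Matrix (n ⊕ n) (n ⊕ n) ℂ) (hPQ : P * Q = 1) :
    xᴴ * F * x = F ↔ (Q * x * P)ᴴ * (Pᴴ * F * P) * (Q * x * P) = Pᴴ * F * P := by
  have hQ : Qᴴ * Pᴴ = 1 := by rw [← conjTranspose_mul, hPQ, conjTranspose_one]
  constructor
  · intro h
    calc (Q * x * P)ᴴ * (Pᴴ * F * P) * (Q * x * P)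
        = Pᴴ * xᴴ * (Qᴴ * Pᴴ) * F * (P * Q) * x * P := by
          simp only [conjTranspose_mul, Matrix.mul_assoc]
      _ = Pᴴ * (xᴴ * F * x) * P := by
          rw [hQ, hPQ]; simp only [Matrix.mul_one, Matrix.mul_assoc]
      _ = Pᴴ * F * P := by rw [h]
  · intro h
    have h' : Qᴴ * ((Q * x * P)ᴴ * (Pᴴ * F * P) * (Q * x * P)) * Q = Qᴴ * (Pᴴ * F * P) * Q := by
      rw [h]
    have e1 : Qᴴ * ((Q * x * P)ᴴ * (Pᴴ * F * P) * (Q * x * P)) * Q = xᴴ * F * x := by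
      calc Qᴴ * ((Q * x * P)ᴴ * (Pᴴ * F * P) * (Q * x * P)) * Q
          = (Qᴴ * Pᴴ) * xᴴ * (Qᴴ * Pᴴ) * F * (P * Q) * x * (P * Q) := by
            simp only [conjTranspose_mul, Matrix.mul_assoc]
        _ = xᴴ * F * x := by rw [hQ, hPQ]; simp only [Matrix.one_mul, Matrix.mul_one]
    have e2 : Qᴴ * (Pᴴ * F * P) * Q = F := by
      calc Qᴴ * (Pᴴ * F * P) * Q = (Qᴴ * Pᴴ) * F * (P * Q) := by simp only [Matrix.mul_assoc]
        _ = F := by rw [hQ, hPQ, Matrix.one_mul, Matrix.mul_one]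
    rw [e1, e2] at h'
    exact h'

/-- `U(W ⊕ W⁻)` in the `(a, b)` coordinates is `U(formHJ J)` in the `(y, y′)` coordinates:
`x` preserves `fromBlocks J 0 0 (−J)` iff `P⁻¹ x P` preserves `formHJ J`. -/
theorem transport_preserves (J : Matrix n n ℂ) (x : Matrix (n ⊕ n) (n ⊕ n) ℂ) :
    xᴴ * fromBlocks J 0 0 (-J) * x = fromBlocks J 0 0 (-J) ↔
      (((1 / 2 : ℂ) • (fromBlocks 1 1 1 (-1) : Matrix (n ⊕ n) (n ⊕ n) ℂ)) * x *
          (fromBlocks 1 1 1 (-1) : Matrix (n ⊕ n) (n ⊕ n) ℂ))ᴴ * formHJ J *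
        (((1 / 2 : ℂ) • (fromBlocks 1 1 1 (-1) : Matrix (n ⊕ n) (n ⊕ n) ℂ)) * x *
          (fromBlocks 1 1 1 (-1) : Matrix (n ⊕ n) (n ⊕ n) ℂ)) = formHJ J := by
  have hPQ := basisChange_inv (n := n)
  rw [preserves_conj (fromBlocks J 0 0 (-J)) (fromBlocks 1 1 1 (-1) : Matrix (n ⊕ n) (n ⊕ n) ℂ)
    _ x hPQ, transport_form]
  constructor
  · intro h
    have h2 := congrArg (fun M => (1 / 2 : ℂ) • M) h
    simpa only [Matrix.mul_smul, Matrix.smul_mul, smul_smul, one_div, inv_mul_cancel₀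
      (two_ne_zero' ℂ), one_smul] using h2
  · intro h
    rw [Matrix.mul_smul, Matrix.smul_mul, h]

/-- `fromBlocks g 0 0 1 ∈ U(W ⊕ W⁻)` iff `g ∈ U(J)`. -/
theorem diag_preserves_iff (J g : Matrix n n ℂ) :
    (fromBlocks g 0 0 1)ᴴ * fromBlocks J 0 0 (-J) * fromBlocks g 0 0 1 = fromBlocks J 0 0 (-J) ↔
      gᴴ * J * g = J := by
  simp only [fromBlocks_conjTranspose, fromBlocks_multiply, conjTranspose_zero,
    conjTranspose_one, Matrix.mul_zero, Matrix.zero_mul, Matrix.mul_one, Matrix.one_mul,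
    add_zero, zero_add, fromBlocks_inj, and_true]

end Summit.Ventures.HodgeRepro2.T5DoublingTransport
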